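import Literature.MathematicalPhysics.QuantumManyBody.PeriodicBoseGasRelabelling
import Literature.MathematicalPhysics.QuantumManyBody.BosonicFloorSymmetrisation
import Mathlib.MeasureTheory.Integral.Lebesgue.DominatedConvergence
import HarnessLib

/-!
# The bosonic ground-state energy is the absolute ground-state energy (periodic box)

Topic `Literature/MathematicalPhysics/QuantumManyBody` (companion of `PeriodicBoseGas.lean` and
`PeriodicBoseGasTagged.lean`; wanted by the crux `CorrectorClosure` of
`AtomisticToContinuum/BoseEinsteinCondensation`, line `llp-fidelity-arc`).

For the torus Hamiltonian `H(M, L) = -∑ᵢ Δᵢ^per + ∑_{i<j} v^per(xᵢ - xⱼ)` [Fournais2020, (1.1)]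
with a measurable pair potential `v ≥ 0` (hard cores `v = ⊤` allowed), the infimum of the
quadratic form over Bose-SYMMETRIC periodic `C¹` states (`periodicGroundStateEnergy v M L`) is
bounded by the quadratic form of EVERY periodic `C¹` state, symmetric or not
(`periodicGroundStateEnergy_le_lintegral_of_periodic`): "it is well known that the bosonic
ground-state energy is the absolute ground-state energy" [LSSY2005, Ch. 2]. Consequences for the
tagged-particle problem of `PeriodicBoseGasTagged.lean` at equal masses `κ = 1`:
`periodicGroundStateEnergy v (N+1) L ≤ taggedPeriodicEnergy v 1 Ψ` for every tagged state
(`periodicGroundStateEnergy_succ_le_taggedPeriodicEnergy_one`), hence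
`periodicGroundStateEnergy v (N+1) L ≤ taggedPeriodicGroundStateEnergy v 1 N L`
(`periodicGroundStateEnergy_succ_le_taggedPeriodicGroundStateEnergy_one`) and, with the converse
`taggedPeriodicGroundStateEnergy_one_le` of `PeriodicBoseGasTagged.lean`, EQUALITY
(`taggedPeriodicGroundStateEnergy_one_eq`) — the direction that file deferred to
"Perron–Frobenius".

## Proof (no Perron–Frobenius, no ground state needed)

Given `f` (periodic, `C¹`, `∫_{cell}|f|² = 1`), symmetrise the DENSITY, not the wave function:
`F = ∑_σ |f ∘ (· ∘ σ)|²` over the `M!` relabellings, and regularise its square root,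
`g_ε = √(ε² + F) − ε` (`ε > 0`; the lemmas named `…sqrtSym…` concern `(g_ε : ℂ)`). Then `g_ε` is
`C¹`, periodic and FULLY symmetric (`contDiff_sqrtSym`, `sqrtSym_add_single`, `sqrtSym_comp_perm`);
pointwise `|∇g_ε|² ≤ ∑_σ |∇f|² ∘ (· ∘ σ)` by the convexity inequality for gradients of
`BosonicFloorSymmetrisation.lean` and the relabelling covariance of `|∇·|²`
(`kineticDensity_sqrtSym_le`), and `V g_ε² ≤ V F = ∑_σ (V|f|²) ∘ (· ∘ σ)` since the pair
interaction is relabelling invariant (`energyDensity_sqrtSym_le`). Integrating over the cell,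
which is relabelling invariant, `𝓔[g_ε] ≤ M! 𝓔[f]` (`lintegral_energyDensity_sqrtSym_le`), so the
variational principle for the unnormalised bosonic function `g_ε` gives
`E^per · ‖g_ε‖² ≤ M! 𝓔[f]` (`periodicGroundStateEnergy_mul_lintegral_sqrtSym_le`). Finally
`‖g_ε‖² → ∫F = M!` as `ε = 1/(n+1) → 0` by dominated convergence
(`tendsto_lintegral_nnnorm_sqrtSym_sq`), and `M!` cancels.

## References

* [LSSY2005] E. H. Lieb, R. Seiringer, J. P. Solovej, J. Yngvason, *The Mathematics of the Bose
  Gas and its Condensation*, Birkhäuser 2005 (arXiv:cond-mat/0610117), Ch. 2 (2.1) and the remark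
  that the bosonic ground-state energy is the absolute one.
* [LiebLoss2001] E. H. Lieb, M. Loss, *Analysis*, 2nd ed., AMS 2001, Thm. 7.8 (convexity
  inequality for gradients).
* [Fournais2020] S. Fournais, *Length scales for BEC in the dilute Bose gas*, arXiv:2011.00309,
  (1.1)–(1.2).
-/

noncomputable section

open MeasureTheory Filter Topology
open scoped ENNReal NNReal

namespace Literature.MathematicalPhysics.QuantumManyBody.BoseGas

variable {M : ℕ} {L : ℝ}

/-- The periodised potential of a measurable profile is measurable. [folklore] -/
private theorem measurable_periodizedPotential_bf {v : ℝ → ℝ≥0∞} (hv : Measurable v) (L : ℝ) :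
    Measurable (periodizedPotential v L) := by
  show Measurable fun x => ∑' n : Fin 3 → ℤ, v ‖x - latticeVec L n‖
  exact Measurable.tsum fun n => hv.comp (measurable_id.sub_const _).norm

/-- The periodic pair interaction of a measurable profile is measurable. [folklore] -/
private theorem measurable_periodicInteraction_bf {v : ℝ → ℝ≥0∞} (hv : Measurable v) (L : ℝ) :
    Measurable fun X : Config M => periodicInteraction v L X := by
  unfold periodicInteraction
  refine Finset.measurable_sum _ fun i _ => Finset.measurable_sum _ fun j _ => ?_
  exact (measurable_periodizedPotential_bf hv L).comp
    ((measurable_pi_apply i).sub (measurable_pi_apply j))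

/-! ### The regularised symmetrised modulus as a trial function

Throughout, `g_ε(X) = √(ε² + ∑_σ ‖f(X ∘ σ)‖²) − ε`, viewed as the complex-valued function
`X ↦ (g_ε(X) : ℂ)` on `(ℝ³)^M` (written out in full in every statement). -/

section SqrtSym

variable {f : Config M → ℂ} {ε : ℝ}

/-- `g_ε` is `C¹` for `C¹` `f` and `ε > 0`. [folklore] -/
theorem contDiff_sqrtSym (hf : ContDiff ℝ 1 f) (hε : 0 < ε) :
    ContDiff ℝ 1 (fun X : Config M =>
        ((Real.sqrt (ε ^ 2 + ∑ σ : Equiv.Perm (Fin M), ‖f (X ∘ σ)‖ ^ 2) - ε : ℝ) : ℂ)) :=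
  Complex.ofRealCLM.contDiff.comp
    (contDiff_sqrtReg (fun (σ : Equiv.Perm (Fin M)) (X : Config M) => f (X ∘ σ))
      (fun σ => contDiff_comp_perm hf σ) hε)

/-- `g_ε` is symmetric under ALL permutations of the particles. [folklore] -/
theorem sqrtSym_comp_perm (f : Config M → ℂ) (ε : ℝ) (τ : Equiv.Perm (Fin M)) (X : Config M) :
    ((Real.sqrt (ε ^ 2 + ∑ σ : Equiv.Perm (Fin M), ‖f ((X ∘ τ) ∘ σ)‖ ^ 2) - ε : ℝ) : ℂ) =
      ((Real.sqrt (ε ^ 2 + ∑ σ : Equiv.Perm (Fin M), ‖f (X ∘ σ)‖ ^ 2) - ε : ℝ) : ℂ) := by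
  simp only [sum_norm_sq_comp_perm]

/-- `g_ε` is periodic in every particle and axis when `f` is. [folklore] -/
theorem sqrtSym_add_single
    (hper : ∀ (X : Config M) (i : Fin M) (k : Fin 3),
      f (X + Pi.single i (EuclideanSpace.single k L)) = f X)
    (ε : ℝ) (X : Config M) (i : Fin M) (k : Fin 3) :
    ((Real.sqrt (ε ^ 2 + ∑ σ : Equiv.Perm (Fin M),
        ‖f ((X + Pi.single i (EuclideanSpace.single k L)) ∘ σ)‖ ^ 2) - ε : ℝ) : ℂ) =
      ((Real.sqrt (ε ^ 2 + ∑ σ : Equiv.Perm (Fin M), ‖f (X ∘ σ)‖ ^ 2) - ε : ℝ) : ℂ) := by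
  simp only [sum_norm_sq_comp_perm_add_single hper]

/-- **Pointwise kinetic bound** (convexity of `ρ ↦ |∇√ρ|²` plus relabelling covariance):
`|∇g_ε|²(X) ≤ ∑_σ |∇f|²(X ∘ σ)`. [cite: LiebLoss2001, Thm. 7.8] -/
theorem kineticDensity_sqrtSym_le (hf : ContDiff ℝ 1 f) (hε : 0 < ε) (X : Config M) :
    kineticDensity (fun Y : Config M =>
        ((Real.sqrt (ε ^ 2 + ∑ σ : Equiv.Perm (Fin M), ‖f (Y ∘ σ)‖ ^ 2) - ε : ℝ) : ℂ)) X ≤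
      ∑ σ : Equiv.Perm (Fin M), kineticDensity f (X ∘ σ) := by
  have hd : Differentiable ℝ f := hf.differentiable one_ne_zero
  have hdσ : ∀ σ : Equiv.Perm (Fin M), DifferentiableAt ℝ (fun Y : Config M => f (Y ∘ σ)) X :=
    fun σ => ((contDiff_comp_perm hf σ).differentiable one_ne_zero) X
  calc kineticDensity (fun Y : Config M =>
        ((Real.sqrt (ε ^ 2 + ∑ σ : Equiv.Perm (Fin M), ‖f (Y ∘ σ)‖ ^ 2) - ε : ℝ) : ℂ)) X
      ≤ ∑ i : Fin M, ∑ k : Fin 3, ∑ σ : Equiv.Perm (Fin M),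
          ((‖fderiv ℝ (fun Y : Config M => f (Y ∘ σ)) X
            (Pi.single i (EuclideanSpace.single k (1 : ℝ)))‖₊ : ℝ≥0∞)) ^ 2 :=
        Finset.sum_le_sum fun i _ => Finset.sum_le_sum fun k _ =>
          nnnorm_fderiv_ofReal_sqrtReg_sq_le (fun (σ : Equiv.Perm (Fin M)) (Y : Config M) =>
            f (Y ∘ σ)) hdσ hε _
    _ = ∑ i : Fin M, ∑ σ : Equiv.Perm (Fin M), ∑ k : Fin 3,
          ((‖fderiv ℝ (fun Y : Config M => f (Y ∘ σ)) X
            (Pi.single i (EuclideanSpace.single k (1 : ℝ)))‖₊ : ℝ≥0∞)) ^ 2 :=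
        Finset.sum_congr rfl fun i _ => Finset.sum_comm
    _ = ∑ σ : Equiv.Perm (Fin M), kineticDensity (fun Y : Config M => f (Y ∘ σ)) X :=
        Finset.sum_comm
    _ = ∑ σ : Equiv.Perm (Fin M), kineticDensity f (X ∘ σ) :=
        Finset.sum_congr rfl fun σ _ => kineticDensity_comp_perm σ hd X

/-- `‖g_ε(X)‖₊² ≤ ∑_σ ‖f(X ∘ σ)‖₊²` (from `g_ε² ≤ ∑_σ |f ∘ σ|²`). [folklore] -/
theorem nnnorm_sqrtSym_sq_le (f : Config M → ℂ) (hε : 0 < ε) (X : Config M) :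
    ((‖((Real.sqrt (ε ^ 2 + ∑ σ : Equiv.Perm (Fin M), ‖f (X ∘ σ)‖ ^ 2) - ε : ℝ) : ℂ)‖₊ : ℝ≥0∞)) ^ 2 ≤
      ∑ σ : Equiv.Perm (Fin M), ((‖f (X ∘ σ)‖₊ : ℝ≥0∞)) ^ 2 :=
  nnnorm_ofReal_sqrtReg_sq_le (fun (σ : Equiv.Perm (Fin M)) (Y : Config M) => f (Y ∘ σ)) X hε

/-- **Pointwise energy-density bound**: `|∇g_ε|² + V g_ε² ≤ ∑_σ (|∇f|² + V |f|²) ∘ (· ∘ σ)`, using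
the relabelling invariance of `V = ∑_{i<j} v^per(xᵢ - xⱼ)`. [folklore] -/
theorem energyDensity_sqrtSym_le (hf : ContDiff ℝ 1 f) (hε : 0 < ε) (v : ℝ → ℝ≥0∞) (L : ℝ)
    (X : Config M) :
    kineticDensity (fun Y : Config M =>
        ((Real.sqrt (ε ^ 2 + ∑ σ : Equiv.Perm (Fin M), ‖f (Y ∘ σ)‖ ^ 2) - ε : ℝ) : ℂ)) X +
        periodicInteraction v L X *
          ((‖((Real.sqrt (ε ^ 2 + ∑ σ : Equiv.Perm (Fin M), ‖f (X ∘ σ)‖ ^ 2) - ε : ℝ) : ℂ)‖₊ : ℝ≥0∞)) ^ 2 ≤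
      ∑ σ : Equiv.Perm (Fin M), (kineticDensity f (X ∘ σ) +
        periodicInteraction v L (X ∘ σ) * ((‖f (X ∘ σ)‖₊ : ℝ≥0∞)) ^ 2) := by
  rw [Finset.sum_add_distrib]
  refine add_le_add (kineticDensity_sqrtSym_le hf hε X) ?_
  calc periodicInteraction v L X *
        ((‖((Real.sqrt (ε ^ 2 + ∑ σ : Equiv.Perm (Fin M), ‖f (X ∘ σ)‖ ^ 2) - ε : ℝ) : ℂ)‖₊ : ℝ≥0∞)) ^ 2
      ≤ periodicInteraction v L X * ∑ σ : Equiv.Perm (Fin M), ((‖f (X ∘ σ)‖₊ : ℝ≥0∞)) ^ 2 :=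
        mul_le_mul_right (nnnorm_sqrtSym_sq_le f hε X) _
    _ = ∑ σ : Equiv.Perm (Fin M),
          periodicInteraction v L (X ∘ σ) * ((‖f (X ∘ σ)‖₊ : ℝ≥0∞)) ^ 2 := by
        rw [Finset.mul_sum]
        simp only [periodicInteraction_comp_perm]

/-- **Energy of the regularised symmetrised modulus**: for measurable `v`,
`∫_{cell} (|∇g_ε|² + V g_ε²) ≤ M! · ∫_{cell} (|∇f|² + V|f|²)` (each of the `M!` relabelled copies
has the energy of `f`, by the relabelling invariance of Lebesgue measure on the cell). [folklore] -/
theorem lintegral_energyDensity_sqrtSym_le {v : ℝ → ℝ≥0∞} (hv : Measurable v)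
    (hf : ContDiff ℝ 1 f) (hε : 0 < ε) :
    ∫⁻ X in cellN M L, (kineticDensity (fun Y : Config M =>
        ((Real.sqrt (ε ^ 2 + ∑ σ : Equiv.Perm (Fin M), ‖f (Y ∘ σ)‖ ^ 2) - ε : ℝ) : ℂ)) X +
        periodicInteraction v L X *
          ((‖((Real.sqrt (ε ^ 2 + ∑ σ : Equiv.Perm (Fin M), ‖f (X ∘ σ)‖ ^ 2) - ε : ℝ) : ℂ)‖₊ : ℝ≥0∞)) ^ 2) ≤
      (Fintype.card (Equiv.Perm (Fin M)) : ℝ≥0∞) *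
        ∫⁻ X in cellN M L,
          (kineticDensity f X + periodicInteraction v L X * ((‖f X‖₊ : ℝ≥0∞)) ^ 2) := by
  set Φ : Config M → ℝ≥0∞ := fun X =>
    kineticDensity f X + periodicInteraction v L X * ((‖f X‖₊ : ℝ≥0∞)) ^ 2 with hΦ_def
  have hΦ : Measurable Φ := (measurable_kineticDensity hf).add
    ((measurable_periodicInteraction_bf hv L).mul (measurable_normSq hf.continuous))
  calc ∫⁻ X in cellN M L, (kineticDensity (fun Y : Config M =>
        ((Real.sqrt (ε ^ 2 + ∑ σ : Equiv.Perm (Fin M), ‖f (Y ∘ σ)‖ ^ 2) - ε : ℝ) : ℂ)) X +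
          periodicInteraction v L X *
            ((‖((Real.sqrt (ε ^ 2 + ∑ σ : Equiv.Perm (Fin M), ‖f (X ∘ σ)‖ ^ 2) - ε : ℝ) : ℂ)‖₊ : ℝ≥0∞)) ^ 2)
      ≤ ∫⁻ X in cellN M L, ∑ σ : Equiv.Perm (Fin M), Φ (X ∘ σ) :=
        lintegral_mono fun X => energyDensity_sqrtSym_le hf hε v L X
    _ = ∑ σ : Equiv.Perm (Fin M), ∫⁻ X in cellN M L, Φ (X ∘ σ) :=
        lintegral_finsetSum _ fun σ _ => hΦ.comp (measurable_comp_perm_config σ)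
    _ = ∑ σ : Equiv.Perm (Fin M), ∫⁻ X in cellN M L, Φ X :=
        Finset.sum_congr rfl fun σ _ => setLIntegral_cellN_comp_perm σ Φ
    _ = (Fintype.card (Equiv.Perm (Fin M)) : ℝ≥0∞) * ∫⁻ X in cellN M L, Φ X := by
        rw [Finset.sum_const, Finset.card_univ, nsmul_eq_mul]

/-- `∫_{cell} ∑_σ ‖f(X ∘ σ)‖₊² = M! · ∫_{cell} ‖f‖₊²`. [folklore] -/
theorem lintegral_sum_nnnorm_comp_perm_sq (hf : Continuous f) :
    ∫⁻ X in cellN M L, ∑ σ : Equiv.Perm (Fin M), ((‖f (X ∘ σ)‖₊ : ℝ≥0∞)) ^ 2 =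
      (Fintype.card (Equiv.Perm (Fin M)) : ℝ≥0∞) * ∫⁻ X in cellN M L, ((‖f X‖₊ : ℝ≥0∞)) ^ 2 := by
  have hmeas : ∀ σ : Equiv.Perm (Fin M),
      Measurable fun X : Config M => ((‖f (X ∘ σ)‖₊ : ℝ≥0∞)) ^ 2 :=
    fun σ => (measurable_normSq hf).comp (measurable_comp_perm_config σ)
  rw [lintegral_finsetSum _ fun σ _ => hmeas σ]
  calc ∑ σ : Equiv.Perm (Fin M), ∫⁻ X in cellN M L, ((‖f (X ∘ σ)‖₊ : ℝ≥0∞)) ^ 2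
      = ∑ σ : Equiv.Perm (Fin M), ∫⁻ X in cellN M L, ((‖f X‖₊ : ℝ≥0∞)) ^ 2 :=
        Finset.sum_congr rfl fun σ _ =>
          setLIntegral_cellN_comp_perm σ (fun X => ((‖f X‖₊ : ℝ≥0∞)) ^ 2)
    _ = (Fintype.card (Equiv.Perm (Fin M)) : ℝ≥0∞) * ∫⁻ X in cellN M L, ((‖f X‖₊ : ℝ≥0∞)) ^ 2 := by
        rw [Finset.sum_const, Finset.card_univ, nsmul_eq_mul]

/-- `∫_{cell} ‖g_ε‖₊² ≤ M! · ∫_{cell} ‖f‖₊²`. [folklore] -/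
theorem lintegral_nnnorm_sqrtSym_sq_le (hf : Continuous f) (hε : 0 < ε) :
    ∫⁻ X in cellN M L,
        ((‖((Real.sqrt (ε ^ 2 + ∑ σ : Equiv.Perm (Fin M), ‖f (X ∘ σ)‖ ^ 2) - ε : ℝ) : ℂ)‖₊ : ℝ≥0∞)) ^ 2 ≤
      (Fintype.card (Equiv.Perm (Fin M)) : ℝ≥0∞) * ∫⁻ X in cellN M L, ((‖f X‖₊ : ℝ≥0∞)) ^ 2 := by
  rw [← lintegral_sum_nnnorm_comp_perm_sq hf]
  exact lintegral_mono fun X => nnnorm_sqrtSym_sq_le f hε X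

/-- **The regularised symmetrised modulus as a bosonic trial state**: for measurable `v`, a `C¹`
periodic `f` with `∫_{cell}|f|² < ∞` and `ε > 0`,
`E^per(M, L) · ∫_{cell} g_ε² ≤ M! · ∫_{cell} (|∇f|² + V|f|²)`. [cite: LSSY2005, Ch. 2 (bosons: remark after (2.1))] -/
theorem periodicGroundStateEnergy_mul_lintegral_sqrtSym_le {v : ℝ → ℝ≥0∞} (hv : Measurable v)
    (hf : ContDiff ℝ 1 f)
    (hper : ∀ (X : Config M) (i : Fin M) (k : Fin 3),
      f (X + Pi.single i (EuclideanSpace.single k L)) = f X)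
    (htop : ∫⁻ X in cellN M L, ((‖f X‖₊ : ℝ≥0∞)) ^ 2 ≠ ⊤) (hε : 0 < ε) :
    periodicGroundStateEnergy v M L * ∫⁻ X in cellN M L,
        ((‖((Real.sqrt (ε ^ 2 + ∑ σ : Equiv.Perm (Fin M), ‖f (X ∘ σ)‖ ^ 2) - ε : ℝ) : ℂ)‖₊ : ℝ≥0∞)) ^ 2 ≤
      (Fintype.card (Equiv.Perm (Fin M)) : ℝ≥0∞) *
        ∫⁻ X in cellN M L,
          (kineticDensity f X + periodicInteraction v L X * ((‖f X‖₊ : ℝ≥0∞)) ^ 2) := by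
  have htop' : ∫⁻ X in cellN M L,
      ((‖((Real.sqrt (ε ^ 2 + ∑ σ : Equiv.Perm (Fin M), ‖f (X ∘ σ)‖ ^ 2) - ε : ℝ) : ℂ)‖₊ : ℝ≥0∞)) ^ 2 ≠ ⊤ :=
    ne_top_of_le_ne_top (ENNReal.mul_ne_top (ENNReal.natCast_ne_top _) htop)
      (lintegral_nnnorm_sqrtSym_sq_le hf.continuous hε)
  exact (periodicGroundStateEnergy_mul_lintegral_le v (contDiff_sqrtSym hf hε)
    (fun X i k => sqrtSym_add_single hper ε X i k) (fun σ X => sqrtSym_comp_perm f ε σ X)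
      htop').trans (lintegral_energyDensity_sqrtSym_le hv hf hε)

/-- **Removing the regularisation**: `∫_{cell} g_{1/(n+1)}² → M! · ∫_{cell} |f|²` as `n → ∞`
(dominated convergence: `g_ε² ≤ ∑_σ |f ∘ σ|²`, integrable, and `g_ε² → ∑_σ |f ∘ σ|²` pointwise).
[folklore] -/
theorem tendsto_lintegral_nnnorm_sqrtSym_sq (hf : ContDiff ℝ 1 f)
    (htop : ∫⁻ X in cellN M L, ((‖f X‖₊ : ℝ≥0∞)) ^ 2 ≠ ⊤) :
    Tendsto (fun n : ℕ => ∫⁻ X in cellN M L,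
        ((‖((Real.sqrt ((1 / ((n : ℝ) + 1)) ^ 2 + ∑ σ : Equiv.Perm (Fin M), ‖f (X ∘ σ)‖ ^ 2) - (1 / ((n : ℝ) + 1)) : ℝ) : ℂ)‖₊ : ℝ≥0∞)) ^ 2)
      atTop
      (𝓝 ((Fintype.card (Equiv.Perm (Fin M)) : ℝ≥0∞) *
        ∫⁻ X in cellN M L, ((‖f X‖₊ : ℝ≥0∞)) ^ 2)) := by
  rw [← lintegral_sum_nnnorm_comp_perm_sq hf.continuous]
  refine tendsto_lintegral_of_dominated_convergence
    (fun X => ∑ σ : Equiv.Perm (Fin M), ((‖f (X ∘ σ)‖₊ : ℝ≥0∞)) ^ 2) (fun n => ?_) (fun n => ?_)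
    ?_ ?_
  · exact measurable_normSq (contDiff_sqrtSym hf Nat.one_div_pos_of_nat).continuous
  · exact ae_of_all _ fun X => nnnorm_sqrtSym_sq_le f Nat.one_div_pos_of_nat X
  · rw [lintegral_sum_nnnorm_comp_perm_sq hf.continuous]
    exact ENNReal.mul_ne_top (ENNReal.natCast_ne_top _) htop
  · refine ae_of_all _ fun X => ?_
    have h0 : 0 ≤ ∑ σ : Equiv.Perm (Fin M), ‖f (X ∘ σ)‖ ^ 2 := by positivity
    have h := ENNReal.tendsto_ofReal (tendsto_sqrtReg_sq h0)
    rw [ofReal_sum_norm_sq (fun (σ : Equiv.Perm (Fin M)) (Y : Config M) => f (Y ∘ σ)) X] at h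
    refine h.congr fun n => ?_
    exact (nnnorm_ofReal_sqrtReg_sq_eq
      (fun (σ : Equiv.Perm (Fin M)) (Y : Config M) => f (Y ∘ σ)) X _).symm

end SqrtSym

/-! ### The bosonic ground-state energy is the absolute ground-state energy -/

/-- **The bosonic ground-state energy is the absolute one (periodic box).** For a measurable pair
potential `v ≥ 0` (hard cores allowed) and EVERY `C¹`, `Lℤ³`-periodic wave function `f` of `M`
particles normalised on the cell — with no permutation symmetry whatsoever —
`E^per(M, L) ≤ ∫_{[0,L)^{3M}} (|∇f|² + ∑_{i<j} v^per(xᵢ - xⱼ)|f|²)`: the infimum of the quadratic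
form over Bose-symmetric states equals its infimum over all states. Proof without
Perron–Frobenius: the symmetrised, regularised modulus `g_ε = √(ε² + ∑_σ |f ∘ σ|²) − ε` is an
admissible bosonic trial function with `E^per · ‖g_ε‖² ≤ M! · 𝓔[f]`
(`periodicGroundStateEnergy_mul_lintegral_sqrtSym_le`), and `‖g_ε‖² → M!` as `ε → 0`.
[cite: LSSY2005, Ch. 2 (bosons: remark after (2.1))] -/
theorem periodicGroundStateEnergy_le_lintegral_of_periodic {v : ℝ → ℝ≥0∞} (hv : Measurable v)
    {f : Config M → ℂ} (hf : ContDiff ℝ 1 f)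
    (hper : ∀ (X : Config M) (i : Fin M) (k : Fin 3),
      f (X + Pi.single i (EuclideanSpace.single k L)) = f X)
    (hf1 : ∫⁻ X in cellN M L, ((‖f X‖₊ : ℝ≥0∞)) ^ 2 = 1) :
    periodicGroundStateEnergy v M L ≤
      ∫⁻ X in cellN M L,
        (kineticDensity f X + periodicInteraction v L X * ((‖f X‖₊ : ℝ≥0∞)) ^ 2) := by
  set E := ∫⁻ X in cellN M L,
    (kineticDensity f X + periodicInteraction v L X * ((‖f X‖₊ : ℝ≥0∞)) ^ 2) with hE
  set E₀ := periodicGroundStateEnergy v M L with hE₀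
  set c : ℝ≥0∞ := (Fintype.card (Equiv.Perm (Fin M)) : ℝ≥0∞) with hc
  have hc0 : c ≠ 0 := Nat.cast_ne_zero.2 Fintype.card_ne_zero
  have hctop : c ≠ ⊤ := ENNReal.natCast_ne_top _
  have htop : ∫⁻ X in cellN M L, ((‖f X‖₊ : ℝ≥0∞)) ^ 2 ≠ ⊤ := by
    rw [hf1]; exact ENNReal.one_ne_top
  have hlim : Tendsto (fun n : ℕ => E₀ * ∫⁻ X in cellN M L,
      ((‖((Real.sqrt ((1 / ((n : ℝ) + 1)) ^ 2 + ∑ σ : Equiv.Perm (Fin M), ‖f (X ∘ σ)‖ ^ 2) - (1 / ((n : ℝ) + 1)) : ℝ) : ℂ)‖₊ :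
        ℝ≥0∞)) ^ 2) atTop (𝓝 (E₀ * c)) := by
    have h := tendsto_lintegral_nnnorm_sqrtSym_sq hf htop
    rw [hf1, mul_one] at h
    exact ENNReal.Tendsto.const_mul h (Or.inl hc0)
  have hle : E₀ * c ≤ c * E :=
    le_of_tendsto' hlim fun n =>
      periodicGroundStateEnergy_mul_lintegral_sqrtSym_le hv hf hper htop Nat.one_div_pos_of_nat
  calc E₀ = E₀ * c / c := (ENNReal.mul_div_cancel_right hc0 hctop).symm
    _ ≤ c * E / c := ENNReal.div_le_div_right hle c
    _ = E := by rw [mul_comm, ENNReal.mul_div_cancel_right hc0 hctop]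

/-- **Bosonic floor for tagged states.** For measurable `v` and every tagged state `Ψ` (particle
`0` distinguishable, bath Bose-symmetric), `E^per(N+1, L) ≤ ⟨Ψ, H(N+1, L) Ψ⟩ =
taggedPeriodicEnergy v 1 Ψ`. [cite: LSSY2005, Ch. 2 (bosons: remark after (2.1))] -/
theorem periodicGroundStateEnergy_succ_le_taggedPeriodicEnergy_one {N : ℕ} {v : ℝ → ℝ≥0∞}
    (hv : Measurable v) (Ψ : TaggedPeriodicTrialState N L) :
    periodicGroundStateEnergy v (N + 1) L ≤ taggedPeriodicEnergy v 1 Ψ := by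
  rw [taggedPeriodicEnergy_one]
  exact periodicGroundStateEnergy_le_lintegral_of_periodic hv Ψ.contDiff Ψ.periodic Ψ.norm_eq

/-- **The bosonic ground-state energy is below the tagged (bath-symmetric) one**:
`E^per(N+1, L) ≤ E^tagged_{κ=1}(N, L)` for measurable `v`; with
`taggedPeriodicGroundStateEnergy_one_le` this is equality. [cite: LSSY2005, Ch. 2 (bosons: remark after (2.1))] -/
theorem periodicGroundStateEnergy_succ_le_taggedPeriodicGroundStateEnergy_one {v : ℝ → ℝ≥0∞}
    (hv : Measurable v) (N : ℕ) (L : ℝ) :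
    periodicGroundStateEnergy v (N + 1) L ≤ taggedPeriodicGroundStateEnergy v 1 N L :=
  le_iInf fun Ψ => periodicGroundStateEnergy_succ_le_taggedPeriodicEnergy_one hv Ψ

/-- **Equal masses: the tagged and the bosonic ground-state energies coincide**,
`E^tagged_{κ=1}(N, L) = E^per(N+1, L)` (measurable `v`). [cite: LSSY2005, Ch. 2 (bosons: remark after (2.1))] -/
theorem taggedPeriodicGroundStateEnergy_one_eq {v : ℝ → ℝ≥0∞} (hv : Measurable v) (N : ℕ)
    (L : ℝ) : taggedPeriodicGroundStateEnergy v 1 N L = periodicGroundStateEnergy v (N + 1) L :=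
  le_antisymm (taggedPeriodicGroundStateEnergy_one_le v N L)
    (periodicGroundStateEnergy_succ_le_taggedPeriodicGroundStateEnergy_one hv N L)

end Literature.MathematicalPhysics.QuantumManyBody.BoseGas

end
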